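import Summits.QuantumAdvantage.QuantumAdvantage.Theorems.CubicForrelationSignedExactCubicForrelationNotPrBPPFinderMachineBricks

/-!
# Crux `CubicForrelation.SignedExactCubicForrelationNotPrBPP` (stmt-QuantumAdvantage-13932), line `dual-pingpong-frame`:
# the finder machine `findV2`, II — certification, greedy merge and radical descent (definitions and `CodeFP`)

Support file (`--supports stmt-QuantumAdvantage-13932`) toward the registered sub-goals `findV2_mem_FP` /
`findV2_sound`; sequel of `…FinderMachineBricks.lean`, prequel of `…FinderMachine.lean` (where the whole
algorithm is described). In the context `Γ = (n, m, β, C₁, T, Bs, As)` of a run (`Ctx`) this file defines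
the CERTIFICATE of a row list (`certMid`: `0 < |S| ≤ m`, ISO `uᵀ B_v = 0` on rows, and the coset-affine test
of `MMReadout.certOK` — second differences of `g` along row pairs vanish at `0` and the unit vectors), the
GREEDY MERGE of certified seed orbits (`tryMerge`, `mergeStep`, `mergeAll`) and the RADICAL DESCENT (`stackE`
= a basis of `∩_{s∈S} ker B_s`, `complOf`, `tryVec`, `descStep`, `descAll`), and proves them polynomial time
on codes (`descMerge_codeFP`, registered brick): the two loops are `foldlInv` folds whose states keep the
shape invariant "at most `n` rows of at most `n` bits" (`shaped_mergeStep`, `shaped_descStep`).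

## References

* S. Arora, B. Barak, *Computational Complexity: A Modern Approach*, CUP 2009, §1.3. [AroraBarak2009]
* C. Carlet, *Boolean Functions for Cryptography and Coding Theory*, CUP 2021, Prop. 54. [Carlet2020]
* A. Kipnis, A. Shamir, *Cryptanalysis of the HFE public key cryptosystem by relinearization*, CRYPTO 1999, §4. [KipnisShamir1999]
* D. E. Knuth, *TAOCP* Vol. 2, 3rd ed., §4.6.2 Algorithm N. [KnuthTAOCP2]
-/

noncomputable section

set_option linter.dupNamespace false -- D-0017: single-problem summit ⇒ `QuantumAdvantage.QuantumAdvantage` by design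

namespace Summit.QuantumAdvantage.QuantumAdvantage.Theorems.SignedExactCubicForrelationNotPrBPP.FinderMachine

open _root_.Computability Literature.Computability.Complexity Literature.Computability.Complexity.CodeFP
open Literature.Computability.QuantumComplexity
open Literature.Computability.Complexity.F2Elim (bxorL Row rrun isPiv prow kvec bitsE stCE)
open ForrCode QuadSampler CubicDequant MMReadout

/-! ### The context of a run -/

/-- The context `Γ = (n, (m, (β, (C₁, (T, (Bs, As))))))` of a run. [folklore] -/
abbrev Ctx : Type := ℕ × (ℕ × (ℕ × (PCirc × (Ten × (List Mat × List Mat)))))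

/-- Its code. [folklore] -/
abbrev ctxE : Ctx → List Bool := pairE unE (pairE unE (pairE unE (pairE pcE (pairE tenE (pairE (rawE matE) (rawE matE))))))

/-- `n`. [folklore] -/
abbrev cn (Γ : Ctx) : ℕ := Γ.1
/-- `m = n / 2`. [folklore] -/
abbrev cm (Γ : Ctx) : ℕ := Γ.2.1
/-- The budget `β`. [folklore] -/
abbrev cbud (Γ : Ctx) : ℕ := Γ.2.2.1
/-- The circuit of `g`. [folklore] -/
abbrev cc (Γ : Ctx) : PCirc := Γ.2.2.2.1
/-- The tensor of `g`. [folklore] -/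
abbrev cT (Γ : Ctx) : Ten := Γ.2.2.2.2.1
/-- The unit slices of the tensor of `g`. [folklore] -/
abbrev cBs (Γ : Ctx) : List Mat := Γ.2.2.2.2.2.1
/-- The unit slices of the tensor of `f`. [folklore] -/
abbrev cAs (Γ : Ctx) : List Mat := Γ.2.2.2.2.2.2

/-! ### The machine -/

/-- Span membership by rank: appending `v` keeps the rank. [cite: KnuthTAOCP2, §4.6.2 Algorithm N] -/
def inSpan (n : ℕ) (M : Mat) (v : Vec) : Bool := decide (npiv n (rrun n (M ++ [v])) = npiv n (rrun n M))

/-- ISO: `Σ_{i,j} uᵢ vⱼ T[i][j][k] = 0` for all rows `u, v` of `S` and all `k` (`uᵀ B_v = 0`). [folklore] -/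
def isoOK (n : ℕ) (T : Ten) (S : Mat) : Bool :=
  (S.product S).all fun uv => (xorSel n (sliceT n T uv.2) uv.1).all fun b => !b

/-- COSET-AFFINE on rows: every second difference `D_r D_s g` of two rows vanishes at `0ⁿ` and at the unit
vectors (the test of `MMReadout.certOK`). [cite: Carlet2020, Prop. 54] -/
def affOK (n : ℕ) (c : PCirc) (S : Mat) : Bool := (S.product S).all fun rs => (unitPts n).all fun y => !d2 c y rs.1 rs.2

/-- CERTIFIED: `0 < |S| ≤ m`, ISO and COSET-AFFINE. [cite: Carlet2020, Prop. 54] -/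
def certMid (Γ : Ctx) (S : Mat) : Bool :=
  decide (0 < S.length) && decide (S.length ≤ cm Γ) && isoOK (cn Γ) (cT Γ) S && affOK (cn Γ) (cc Γ) S

/-- Merging a (non-failed, certified) orbit `O` into `S` when the merged basis stays certified of `dim ≤ m`.
[folklore] -/
def tryMerge (Γ : Ctx) (S O : Mat) : Mat :=
  if decide (cm Γ < O.length) || !certMid Γ O then S
  else if decide ((basisOf (cn Γ) (S ++ O)).length ≤ cm Γ) && certMid Γ (basisOf (cn Γ) (S ++ O)) then basisOf (cn Γ) (S ++ O)
  else S

/-- One step of the greedy merge (seed `s`, state `S`). [folklore] -/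
def mergeStep (Γ : Ctx) (s : Vec) (S : Mat) : Mat :=
  if decide (S.length = cm Γ) || inSpan (cn Γ) S s then S else tryMerge Γ S (orbitOf (cn Γ) (cm Γ) (cBs Γ) (cAs Γ) s)

/-- **The greedy merge** over the seed list, from `S = []`. [folklore] -/
def mergeAll (Γ : Ctx) (seeds : Mat) : Mat := seeds.foldl (fun S s => mergeStep Γ s S) []

/-- One step of the complement scan: keep `e` (normalised) if it is outside `span (S ++ comp)`. [folklore] -/
def compStep (n : ℕ) (S : Mat) (e : Vec) (comp : Mat) : Mat :=
  if decide (comp.length < n) && !inSpan n (S ++ comp) e then comp ++ [normV n e] else comp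

/-- Rows of `E` completing `span S ∩ span E` to `span E` (greedy). [folklore] -/
def complOf (n : ℕ) (S E : Mat) : Mat := E.foldl (fun comp e => compStep n S e comp) []

/-- `E(S)`: a basis of `∩_{s ∈ S} ker B_s`, the kernel of the stacked slices. [cite: KipnisShamir1999, §4] -/
def stackE (Γ : Ctx) (S : Mat) : Mat := kerOf (cn Γ) (S.map fun s => sliceT (cn Γ) (cT Γ) s).flatten

/-- The descent test of a candidate `v`: `v ≠ 0`, `v ∉ span S`, rank test, non-failed orbit and a certified
merged basis of `dim ≤ m` — returned if so. [folklore] -/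
def tryVec (Γ : Ctx) (S : Mat) (v : Vec) : Option Mat :=
  if v.any (fun b => b) && !inSpan (cn Γ) S v && rankTrue (cn Γ) (cT Γ) v then
    if decide (cm Γ < (orbitOf (cn Γ) (cm Γ) (cBs Γ) (cAs Γ) v).length) then none
    else if decide ((basisOf (cn Γ) (S ++ orbitOf (cn Γ) (cm Γ) (cBs Γ) (cAs Γ) v)).length ≤ cm Γ) &&
        certMid Γ (basisOf (cn Γ) (S ++ orbitOf (cn Γ) (cm Γ) (cBs Γ) (cAs Γ) v)) then
      some (basisOf (cn Γ) (S ++ orbitOf (cn Γ) (cm Γ) (cBs Γ) (cAs Γ) v))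
    else none
  else none

/-- **One round of the radical descent.** [cite: KipnisShamir1999, §4] -/
def descStep (Γ : Ctx) (S : Mat) : Mat :=
  if decide (S.length = 0) || decide (cm Γ ≤ S.length) then S
  else if decide ((stackE Γ S).length < cm Γ) || decide (cbud Γ < 2 * 2 ^ ((stackE Γ S).drop (cm Γ)).length) then S
  else ((spanPrefix (cn Γ) (cbud Γ) ((complOf (cn Γ) S (stackE Γ S)).take (((stackE Γ S).drop (cm Γ)).length + 1))).findSome?
    fun v => tryVec Γ S v).getD S

/-- **The descent**: `m` rounds. [cite: KipnisShamir1999, §4] -/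
def descAll (Γ : Ctx) (S : Mat) : Mat := (List.replicate (cm Γ) ()).foldl (fun S _ => descStep Γ S) S

/-! ### Shapes of the loop states -/

/-- `tryMerge` returns `S` or a basis. [folklore] -/
theorem shaped_tryMerge (Γ : Ctx) {S : Mat} (O : Mat) (h : S.length ≤ cn Γ ∧ ∀ r ∈ S, r.length ≤ cn Γ) :
    (tryMerge Γ S O).length ≤ cn Γ ∧ ∀ r ∈ tryMerge Γ S O, r.length ≤ cn Γ := by
  unfold tryMerge; split_ifs <;> first | exact h | exact shaped_basisOf _ _

/-- `mergeStep` keeps the shape. [folklore] -/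
theorem shaped_mergeStep (Γ : Ctx) (s : Vec) {S : Mat} (h : S.length ≤ cn Γ ∧ ∀ r ∈ S, r.length ≤ cn Γ) :
    (mergeStep Γ s S).length ≤ cn Γ ∧ ∀ r ∈ mergeStep Γ s S, r.length ≤ cn Γ := by
  unfold mergeStep; split_ifs <;> first | exact h | exact shaped_tryMerge Γ _ h

/-- `compStep` keeps the shape. [folklore] -/
theorem shaped_compStep (n : ℕ) (S : Mat) (e : Vec) {comp : Mat} (h : comp.length ≤ n ∧ ∀ r ∈ comp, r.length ≤ n) :
    (compStep n S e comp).length ≤ n ∧ ∀ r ∈ compStep n S e comp, r.length ≤ n := by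
  unfold compStep; split_ifs with hc
  · refine ⟨?_, ?_⟩
    · rw [List.length_append, List.length_singleton]
      simp only [Bool.and_eq_true, decide_eq_true_eq] at hc; omega
    intro r hr; rcases List.mem_append.1 hr with hr | hr
    · exact h.2 r hr
    · rw [List.mem_singleton.1 hr, length_normV]
  · exact h

/-- `tryVec` only returns bases. [folklore] -/
theorem shaped_tryVec (Γ : Ctx) (S : Mat) (v : Vec) {C : Mat} (h : tryVec Γ S v = some C) :
    C.length ≤ cn Γ ∧ ∀ r ∈ C, r.length ≤ cn Γ := by
  unfold tryVec at h; split_ifs at h; cases h; exact shaped_basisOf _ _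

/-- `descStep` keeps the shape. [folklore] -/
theorem shaped_descStep (Γ : Ctx) {S : Mat} (h : S.length ≤ cn Γ ∧ ∀ r ∈ S, r.length ≤ cn Γ) :
    (descStep Γ S).length ≤ cn Γ ∧ ∀ r ∈ descStep Γ S, r.length ≤ cn Γ := by
  unfold descStep; split_ifs <;> try exact h
  generalize hfs : List.findSome? _ _ = o
  cases o with
  | none => exact h
  | some C => obtain ⟨v, -, hv⟩ := List.exists_of_findSome?_eq_some hfs; exact shaped_tryVec Γ S v hv

/-! ### Polynomial time -/

/-- The span test on codes: `(n, (M, v)) ↦ inSpan n M v`. [cite: AroraBarak2009, §1.3] -/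
theorem inSpan_codeFP : CodeFP (pairE unE (pairE matE bitsE)) bitE (fun t => inSpan t.1 t.2.1 t.2.2) := by
  have hn : CodeFP (pairE unE (pairE matE bitsE)) unE (fun t => t.1) := fst _ _
  have hM : CodeFP (pairE unE (pairE matE bitsE)) matE (fun t => t.2.1) := (snd _ _).fst'
  have hMv := (rawAppend bitsE).comp (hM.pair ((rawSingleton bitsE).comp (snd unE (pairE matE bitsE)).snd'))
  have h1 := npiv_codeFP.comp (hn.pair (F2Elim.rrun_codeFP.comp (hn.pair hMv)))
  have h2 := npiv_codeFP.comp (hn.pair (F2Elim.rrun_codeFP.comp (hn.pair hM)))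
  exact (natEq.comp (h1.pair h2)).congr fun _ => rfl

/-- ISO on codes: `((n, T), S) ↦ isoOK n T S`. [cite: AroraBarak2009, §1.3] -/
theorem isoOK_codeFP : CodeFP (pairE (pairE unE tenE) matE) bitE (fun t => isoOK t.1.1 t.1.2 t.2) := by
  have hall0 := CodeFP.all (σ := Unit) (eσ := unitE) (eα := bitE) (p := fun q => !q.2) (snd _ _).not
  -- item `(u, v)`, context `((n, T), S)`
  have hn : CodeFP (pairE (pairE (pairE unE tenE) matE) (pairE bitsE bitsE)) unE (fun q => q.1.1.1) := (fst _ _).fst'.fst'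
  have hT : CodeFP (pairE (pairE (pairE unE tenE) matE) (pairE bitsE bitsE)) tenE (fun q => q.1.1.2) := (fst _ _).fst'.snd'
  have hu : CodeFP (pairE (pairE (pairE unE tenE) matE) (pairE bitsE bitsE)) bitsE (fun q => q.2.1) := (snd _ _).fst'
  have hv : CodeFP (pairE (pairE (pairE unE tenE) matE) (pairE bitsE bitsE)) bitsE (fun q => q.2.2) := (snd _ _).snd'
  have hx := xorSel_codeFP.comp (hn.pair ((sliceT_codeFP.comp (hn.pair (hT.pair hv))).pair hu))
  have hp := hall0.comp ((const _ ()).pair hx)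
  have hall := CodeFP.all (σ := (ℕ × Ten) × Mat) (eσ := pairE (pairE unE tenE) matE) (eα := pairE bitsE bitsE)
    (p := fun q => (xorSel q.1.1.1 (sliceT q.1.1.1 q.1.1.2 q.2.2) q.2.1).all fun b => !b) (hp.congr fun _ => rfl)
  have hprod := (rawProduct bitsE bitsE).comp ((snd (pairE unE tenE) matE).pair (snd (pairE unE tenE) matE))
  exact (hall.comp ((CodeFP.id _).pair hprod)).congr fun _ => rfl

/-- COSET-AFFINE on codes: `((n, c), S) ↦ affOK n c S` (as in `MMReadout.certOK_codeFP`). [cite: AroraBarak2009, §1.3] -/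
theorem affOK_codeFP : CodeFP (pairE (pairE unE pcE) matE) bitE (fun t => affOK t.1.1 t.1.2 t.2) := by
  have hinner := CodeFP.all (σ := ((ℕ × PCirc) × Mat) × (Vec × Vec)) (eσ := pairE (pairE (pairE unE pcE) matE) (pairE bitsE bitsE)) (eα := bitsE)
    (p := fun q => !d2 q.1.1.1.2 q.2 q.1.2.1 q.1.2.2)
    (d2_codeFP.comp ((fst _ _).fst'.fst'.snd'.pair ((snd _ _).pair ((fst _ _).snd'.fst'.pair (fst _ _).snd'.snd')))).not
  have hpts := unitPts_codeFP.comp (fst (pairE (pairE unE pcE) matE) (pairE bitsE bitsE)).fst'.fst'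
  have hin := hinner.comp ((CodeFP.id _).pair hpts)
  have houter := CodeFP.all (σ := (ℕ × PCirc) × Mat) (eσ := pairE (pairE unE pcE) matE) (eα := pairE bitsE bitsE)
    (p := fun q => (unitPts q.1.1.1).all fun y => !d2 q.1.1.2 y q.2.1 q.2.2) (hin.congr fun _ => rfl)
  have hprod := (rawProduct bitsE bitsE).comp ((snd (pairE unE pcE) matE).pair (snd (pairE unE pcE) matE))
  exact (houter.comp ((CodeFP.id _).pair hprod)).congr fun _ => rfl

/-- The context projections on codes. [folklore] -/
theorem ctx_codeFP : CodeFP ctxE unE cn ∧ CodeFP ctxE unE cm ∧ CodeFP ctxE unE cbud ∧ CodeFP ctxE pcE cc ∧ CodeFP ctxE tenE cT ∧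
    CodeFP ctxE (rawE matE) cBs ∧ CodeFP ctxE (rawE matE) cAs :=
  ⟨fst _ _, (snd _ _).fst', (snd _ _).snd'.fst', (snd _ _).snd'.snd'.fst', (snd _ _).snd'.snd'.snd'.fst',
    (snd _ _).snd'.snd'.snd'.snd'.fst', (snd _ _).snd'.snd'.snd'.snd'.snd'⟩

/-- CERTIFIED on codes: `(Γ, S) ↦ certMid Γ S`. [cite: AroraBarak2009, §1.3] -/
theorem certMid_codeFP : CodeFP (pairE ctxE matE) bitE (fun t => certMid t.1 t.2) := by
  obtain ⟨cN, cM, -, cC, cTT, -, -⟩ := ctx_codeFP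
  have hΓ : CodeFP (pairE ctxE matE) ctxE (fun t => t.1) := fst _ _
  have hS : CodeFP (pairE ctxE matE) matE (fun t => t.2) := snd _ _
  have hlen := (natLength bitsE).comp hS
  have h0 := natLt.comp ((const (pairE ctxE matE) 0).pair hlen)
  have h1 := natLe.comp (hlen.pair (natOfUn.comp (cM.comp hΓ)))
  have h2 := isoOK_codeFP.comp (((cN.comp hΓ).pair (cTT.comp hΓ)).pair hS)
  have h3 := affOK_codeFP.comp (((cN.comp hΓ).pair (cC.comp hΓ)).pair hS)
  exact (((h0.and h1).and h2).and h3).congr fun _ => rfl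

/-- The orbit of a seed from the context: `(Γ, s) ↦ orbitOf n m Bs As s`. [cite: AroraBarak2009, §1.3] -/
theorem orbitCtx_codeFP : CodeFP (pairE ctxE bitsE) matE (fun t => orbitOf (cn t.1) (cm t.1) (cBs t.1) (cAs t.1) t.2) := by
  obtain ⟨cN, cM, -, -, -, cB, cA⟩ := ctx_codeFP
  have hO := ((cN.pair (cM.pair (cB.pair cA))).comp (fst ctxE bitsE)).pair (snd ctxE bitsE)
  exact (orbitOf_codeFP.comp hO).congr fun _ => rfl

/-- The code of the merge context `(Γ, (S, O))` / `(Γ, (S, v))`. [folklore] -/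
abbrev ME : Ctx × (Mat × Mat) → List Bool := pairE ctxE (pairE matE matE)

/-- `tryMerge` on codes. [cite: AroraBarak2009, §1.3] -/
theorem tryMerge_codeFP : CodeFP ME matE (fun t => tryMerge t.1 t.2.1 t.2.2) := by
  obtain ⟨cN, cM, -, -, -, -, -⟩ := ctx_codeFP
  have hΓ : CodeFP ME ctxE (fun t => t.1) := fst _ _
  have hS : CodeFP ME matE (fun t => t.2.1) := (snd _ _).fst'
  have hO : CodeFP ME matE (fun t => t.2.2) := (snd _ _).snd'
  have hm := natOfUn.comp (cM.comp hΓ)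
  have hc1 := (natLt.comp (hm.pair ((natLength bitsE).comp hO))).or (certMid_codeFP.comp (hΓ.pair hO)).not
  have hB := basisOf_codeFP.comp ((cN.comp hΓ).pair ((rawAppend bitsE).comp (hS.pair hO)))
  have hc2 := (natLe.comp (((natLength bitsE).comp hB).pair hm)).and (certMid_codeFP.comp (hΓ.pair hB))
  exact (hc1.ite hS (hc2.ite hB hS)).congr fun _ => rfl

/-- `mergeStep` on codes: `(Γ, (s, S)) ↦ mergeStep Γ s S`. [cite: AroraBarak2009, §1.3] -/
theorem mergeStep_codeFP : CodeFP (pairE ctxE (pairE bitsE matE)) matE (fun t => mergeStep t.1 t.2.1 t.2.2) := by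
  obtain ⟨cN, cM, -, -, -, -, -⟩ := ctx_codeFP
  have hΓ : CodeFP (pairE ctxE (pairE bitsE matE)) ctxE (fun t => t.1) := fst _ _
  have hs : CodeFP (pairE ctxE (pairE bitsE matE)) bitsE (fun t => t.2.1) := (snd _ _).fst'
  have hS : CodeFP (pairE ctxE (pairE bitsE matE)) matE (fun t => t.2.2) := (snd _ _).snd'
  have hc := (natEq.comp (((natLength bitsE).comp hS).pair (natOfUn.comp (cM.comp hΓ)))).or
    (inSpan_codeFP.comp ((cN.comp hΓ).pair (hS.pair hs)))
  have ht := tryMerge_codeFP.comp (hΓ.pair (hS.pair (orbitCtx_codeFP.comp (hΓ.pair hs))))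
  exact (hc.ite hS ht).congr fun _ => rfl

/-- A context code is at least `n` long. [folklore] -/
theorem cn_le_length (Γ : Ctx) : cn Γ ≤ (ctxE Γ).length := by
  show Γ.1 ≤ _; simp only [ctxE, pairE_apply, length_boolPair, length_unE]; omega

/-- … hence so is the code of a pair with the context in front. [folklore] -/
theorem cn_le_length_pair {β : Type} (eβ : β → List Bool) (c : Ctx × β) : cn c.1 ≤ (pairE ctxE eβ c).length :=
  (cn_le_length c.1).trans (by rw [pairE_apply, length_boolPair]; omega)

/-- **The greedy merge on codes**: `(Γ, seeds) ↦ mergeAll Γ seeds` (shape-invariant fold). [cite: AroraBarak2009, §1.3] -/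
theorem mergeAll_codeFP : CodeFP (pairE ctxE matE) matE (fun t => mergeAll t.1 t.2) := by
  have h := foldlInv (σ := Ctx) (α := Vec) (β := Mat) (eσ := ctxE) (eα := bitsE) (eβ := matE)
    (step := fun Γ s S => mergeStep Γ s S) (init := fun _ => [])
    (fun Γ S => S.length ≤ cn Γ ∧ ∀ r ∈ S, r.length ≤ cn Γ) mergeStep_codeFP (const _ []) shapeP
    (fun Γ => ⟨Nat.zero_le _, fun _ h => absurd h List.not_mem_nil⟩) (fun Γ s S hS => shaped_mergeStep Γ s hS)
    (fun Γ S hS => length_matE_le_shapeP hS (cn_le_length Γ))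
  exact h.congr fun _ => rfl

/-- `compStep` on codes: `((n, S), (e, comp)) ↦ compStep n S e comp`. [cite: AroraBarak2009, §1.3] -/
theorem compStep_codeFP : CodeFP (pairE (pairE unE matE) (pairE bitsE matE)) matE (fun t => compStep t.1.1 t.1.2 t.2.1 t.2.2) := by
  have hn : CodeFP (pairE (pairE unE matE) (pairE bitsE matE)) unE (fun t => t.1.1) := (fst _ _).fst'
  have hS : CodeFP (pairE (pairE unE matE) (pairE bitsE matE)) matE (fun t => t.1.2) := (fst _ _).snd'
  have he : CodeFP (pairE (pairE unE matE) (pairE bitsE matE)) bitsE (fun t => t.2.1) := (snd _ _).fst'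
  have hk : CodeFP (pairE (pairE unE matE) (pairE bitsE matE)) matE (fun t => t.2.2) := (snd _ _).snd'
  have hc := (natLt.comp (((natLength bitsE).comp hk).pair (natOfUn.comp hn))).and
    (inSpan_codeFP.comp (hn.pair (((rawAppend bitsE).comp (hS.pair hk)).pair he))).not
  have ha := (rawAppend bitsE).comp (hk.pair ((rawSingleton bitsE).comp (normV_codeFP.comp (hn.pair he))))
  exact (hc.ite ha hk).congr fun _ => rfl

/-- The complement scan on codes: `((n, S), E) ↦ complOf n S E` (shape-invariant fold). [cite: AroraBarak2009, §1.3] -/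
theorem complOf_codeFP : CodeFP (pairE (pairE unE matE) matE) matE (fun t => complOf t.1.1 t.1.2 t.2) := by
  have h := foldlInv (σ := ℕ × Mat) (α := Vec) (β := Mat) (eσ := pairE unE matE) (eα := bitsE) (eβ := matE)
    (step := fun c e comp => compStep c.1 c.2 e comp) (init := fun _ => [])
    (fun c comp => comp.length ≤ c.1 ∧ ∀ r ∈ comp, r.length ≤ c.1) compStep_codeFP (const _ []) shapeP
    (fun c => ⟨Nat.zero_le _, fun _ h => absurd h List.not_mem_nil⟩) (fun c e comp hc => shaped_compStep c.1 c.2 e hc)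
    (fun c comp hc => length_matE_le_shapeP hc (by simp only [pairE_apply, length_boolPair, length_unE]; omega))
  exact h.congr fun _ => rfl

/-- `stackE` on codes. [cite: AroraBarak2009, §1.3] -/
theorem stackE_codeFP : CodeFP (pairE ctxE matE) matE (fun t => stackE t.1 t.2) := by
  obtain ⟨cN, -, -, -, cTT, -, -⟩ := ctx_codeFP
  have hm := CodeFP.map (σ := Ctx) (eσ := ctxE) (eα := bitsE) (eβ := matE) (g := fun q => sliceT (cn q.1) (cT q.1) q.2)
    (sliceT_codeFP.comp ((cN.comp (fst ctxE bitsE)).pair ((cTT.comp (fst ctxE bitsE)).pair (snd ctxE bitsE))))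
  have h := kerOf_codeFP.comp ((cN.comp (fst ctxE matE)).pair ((CodeFP.flatten bitsE).comp hm))
  exact h.congr fun _ => rfl

/-- `tryVec` on codes: `(Γ, (S, v)) ↦ tryVec Γ S v`. [cite: AroraBarak2009, §1.3] -/
theorem tryVec_codeFP : CodeFP (pairE ctxE (pairE matE bitsE)) (optE matE) (fun t => tryVec t.1 t.2.1 t.2.2) := by
  obtain ⟨cN, cM, -, -, cTT, -, -⟩ := ctx_codeFP
  have hΓ : CodeFP (pairE ctxE (pairE matE bitsE)) ctxE (fun t => t.1) := fst _ _
  have hS : CodeFP (pairE ctxE (pairE matE bitsE)) matE (fun t => t.2.1) := (snd _ _).fst'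
  have hv : CodeFP (pairE ctxE (pairE matE bitsE)) bitsE (fun t => t.2.2) := (snd _ _).snd'
  have hany0 := CodeFP.any (σ := Unit) (eσ := unitE) (eα := bitE) (p := fun q => q.2) (snd _ _)
  have hany := hany0.comp ((const _ ()).pair hv)
  have hg := (hany.and (inSpan_codeFP.comp ((cN.comp hΓ).pair (hS.pair hv))).not).and
    (rankTrue_codeFP.comp ((cN.comp hΓ).pair ((cTT.comp hΓ).pair hv)))
  have hO := orbitCtx_codeFP.comp (hΓ.pair hv)
  have hm := natOfUn.comp (cM.comp hΓ)
  have hc1 := natLt.comp (hm.pair ((natLength bitsE).comp hO))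
  have hB := basisOf_codeFP.comp ((cN.comp hΓ).pair ((rawAppend bitsE).comp (hS.pair hO)))
  have hc2 := (natLe.comp (((natLength bitsE).comp hB).pair hm)).and (certMid_codeFP.comp (hΓ.pair hB))
  have h := hg.ite (hc1.ite (const _ none) (hc2.ite ((optSome matE).comp hB) (const _ none))) (const _ none)
  exact h.congr fun _ => rfl

/-- **One descent round on codes**: `(Γ, S) ↦ descStep Γ S`. [cite: AroraBarak2009, §1.3] -/
theorem descStep_codeFP : CodeFP (pairE ctxE matE) matE (fun t => descStep t.1 t.2) := by
  obtain ⟨cN, cM, cBud, -, -, -, -⟩ := ctx_codeFP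
  have hΓ : CodeFP (pairE ctxE matE) ctxE (fun t => t.1) := fst _ _
  have hS : CodeFP (pairE ctxE matE) matE (fun t => t.2) := snd _ _
  have hlen := (natLength bitsE).comp hS
  have hm := natOfUn.comp (cM.comp hΓ)
  have hc0 := (natEq.comp (hlen.pair (const _ 0))).or (natLe.comp (hm.pair hlen))
  have hE := stackE_codeFP
  have hEl := (natLength bitsE).comp hE
  have hdrop := (rawDropUn bitsE).comp ((cM.comp hΓ).pair hE)
  have hpow := natMul.comp ((const (pairE ctxE matE) 2).pair (natPow.comp ((const (pairE ctxE matE) 2).pair ((ulength bitsE).comp hdrop))))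
  have hc1 := (natLt.comp (hEl.pair hm)).or (natLt.comp ((natOfUn.comp (cBud.comp hΓ)).pair hpow))
  have hr1 := natAdd.comp (((natLength bitsE).comp hdrop).pair (const (pairE ctxE matE) 1))
  have hcomp := complOf_codeFP.comp (((cN.comp hΓ).pair hS).pair hE)
  have hcands := spanPrefix_codeFP.comp (((cN.comp hΓ).pair (cBud.comp hΓ)).pair ((rawTakeNat bitsE).comp (hr1.pair hcomp)))
  have htv := tryVec_codeFP.comp ((fst (pairE ctxE matE) bitsE).fst'.pair ((fst (pairE ctxE matE) bitsE).snd'.pair (snd (pairE ctxE matE) bitsE)))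
  have hfind := findSomeFP (σ := Ctx × Mat) (eσ := pairE ctxE matE) (eα := bitsE) (eβ := matE) (f := fun q => tryVec q.1.1 q.1.2 q.2) htv
  have hget := optCases (σ := Ctx × Mat) (eσ := pairE ctxE matE) (eα := matE) (eδ := matE) (k := fun s o => o.getD s.2)
    (gnone := fun s => s.2) (gsome := fun t => t.2) (snd _ _) (snd _ _) (fun _ => rfl) (fun _ _ => rfl)
  have hsel := hget.comp ((CodeFP.id _).pair (hfind.comp ((CodeFP.id _).pair hcands)))
  exact (hc0.ite hS (hc1.ite hS hsel)).congr fun _ => rfl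

/-- The merge result is shaped (at most `n` rows of at most `n` bits). [folklore] -/
theorem shaped_mergeAll (Γ : Ctx) (seeds : Mat) : (mergeAll Γ seeds).length ≤ cn Γ ∧ ∀ r ∈ mergeAll Γ seeds, r.length ≤ cn Γ := by
  unfold mergeAll
  induction seeds using List.reverseRecOn with
  | nil => exact ⟨Nat.zero_le _, fun _ h => absurd h List.not_mem_nil⟩
  | append_singleton l s ih => rw [List.foldl_append, List.foldl_cons, List.foldl_nil]; exact shaped_mergeStep Γ s ih

/-- **Merge then descent on codes**: `(Γ, seeds) ↦ descAll Γ (mergeAll Γ seeds)` (shape-invariant fold from the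
shaped merge result). [cite: AroraBarak2009, §1.3] -/
theorem descMerge_codeFP : CodeFP (pairE ctxE matE) matE (fun t => descAll t.1 (mergeAll t.1 t.2)) := by
  obtain ⟨-, cM, -, -, -, -, -⟩ := ctx_codeFP
  have hstep := descStep_codeFP.comp ((fst (pairE ctxE matE) (pairE unitE matE)).fst'.pair (snd (pairE ctxE matE) (pairE unitE matE)).snd')
  have h := foldlInv (σ := Ctx × Mat) (α := Unit) (β := Mat) (eσ := pairE ctxE matE) (eα := unitE) (eβ := matE)
    (step := fun c _ S => descStep c.1 S) (init := fun c => mergeAll c.1 c.2)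
    (fun c S => S.length ≤ cn c.1 ∧ ∀ r ∈ S, r.length ≤ cn c.1) hstep mergeAll_codeFP shapeP
    (fun c => shaped_mergeAll c.1 c.2) (fun c _ S hS => shaped_descStep c.1 hS)
    (fun c S hS => length_matE_le_shapeP hS (cn_le_length_pair matE c))
  have hall := h.comp ((CodeFP.id _).pair (replicateUnit.comp (cM.comp (fst ctxE matE))))
  exact hall.congr fun _ => rfl

end Summit.QuantumAdvantage.QuantumAdvantage.Theorems.SignedExactCubicForrelationNotPrBPP.FinderMachine

end
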